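import Summits.Ventures.CertifiedManyBodySolver.Downfold.EmeryChargeTransferLipschitz
import HarnessLib

/-!
# THE HOPPING LEVERS OF THE ANTIBONDING BAND AND OF THE FERMI ENERGY: `ε_AB` and `ε_F(ν)` are non-decreasing in `t_pd²` and in `t_pp`,
# non-increasing in `t_pp′` (and in `Δ`, `EmeryChargeTransferLipschitz`) — the four one-body parameter directions as certificate-free theorems

Venture CertifiedManyBodySolver, cell `pub/hubbard-downfold` (stage S1; INFLATION-RULES-3to1-B §B.83 (h)), seat hubbard-downfold-mod-4 (technique B,
g34); namespace `Summit.Ventures.CertifiedManyBodySolver.Downfold.Emery`. Everything PROVED (0 sorry, no definition). WHAT THIS IS NOT: a statement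
about any material; `U = 0` one-body kinematics of the σ (d–p_x–p_y + t_pp, t_pp′) model; no number lives here.

* §1 POINTWISE BAND LEVERS at every `(x, y)` with `x, y ≥ 0` (`Δ ≥ 0`, `t_pp, t_pp′ ≥ 0`): `t_pd² ↦ ε_AB` non-decreasing (`abBand_mono_tpdSq`: the
  secular cubic is affine non-increasing in `t_pd²` at non-negative energies), `t_pp ↦ ε_AB` non-decreasing (`abBand_mono_tpp`), `t_pp′ ↦ ε_AB`
  non-increasing (`abBand_anti_tppP`: the rank-two identity `charCubic(t_pp′ + γ; t) = charCubic(t_pp′; t) + 4γx·minorX + 4γy·minorY + 16γ²xy·t`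
  read at `t = ε_AB(t_pp′)` where the minors are `≥ 0`).
* §2 GENERIC TRANSFER: pointwise band domination ⇒ filling domination (`abFilling_le_of_abBand_le`) ⇒ the Fermi energy of every attained filling
  moves the same way as the band (`fermiEnergyOf_le_of_abFilling_le`).
* §3 THE FERMI-ENERGY LEVERS: for `0 < ν < 1` attained at both rows, **`ε_F` is non-decreasing in `t_pd²` and in `t_pp`, non-increasing in `t_pp′`**
  (`fermiEnergyOf_mono_tpdSq`, `fermiEnergyOf_mono_tpp`, `fermiEnergyOf_anti_tppP`); with §B.83 (f) (`Δ`: non-increasing, 1-Lipschitz) all four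
  coordinate directions of the σ row are signed.

Sources: three-band model [HybertsenSchluterChristensen1989, Eq. (1)]; Weyl monotonicity via principal minors [folklore].
-/

noncomputable section

namespace Summit.Ventures.CertifiedManyBodySolver.Downfold.Emery

open Real MeasureTheory Set

/-! ## §1 Pointwise band levers -/

section Band

variable {Δ a a' b b' c c' x y : ℝ}

/-- The secular cubic as an affine function of `t_pd²`: `charCubic(a) − charCubic(a′) = (a′² − a²)·(4x(Δ + 4cy + t) + 4y(Δ + 4cx + t) + 32bxy)`.
[folklore] -/
theorem charCubic_sub_tpd (Δ a a' b c x y t : ℝ) :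
    charCubic Δ a b c x y t - charCubic Δ a' b c x y t =
      (a' ^ 2 - a ^ 2) * (4 * x * (Δ + 4 * c * y + t) + 4 * y * (Δ + 4 * c * x + t) + 32 * b * x * y) := by
  unfold charCubic; ring

/-- **`ε_AB` is non-decreasing in `t_pd²`** (`Δ, t_pp, t_pp′, x, y ≥ 0`). [folklore] -/
theorem abBand_mono_tpdSq (hΔ : 0 ≤ Δ) (hc : 0 ≤ c) (hb : 0 ≤ b) (hx : 0 ≤ x) (hy : 0 ≤ y) (haa : a ^ 2 ≤ a' ^ 2) :
    abBand Δ a b c x y ≤ abBand Δ a' b c x y := by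
  set E := abBand Δ a b c x y with hE
  have hE0 : 0 ≤ E := abBand_nonneg (tpd := a) hΔ hc hb hx hy
  apply le_abBand_of_charCubic_nonpos
  have hid := charCubic_sub_tpd Δ a a' b c x y E
  rw [charCubic_abBand] at hid
  have : 0 ≤ (a' ^ 2 - a ^ 2) * (4 * x * (Δ + 4 * c * y + E) + 4 * y * (Δ + 4 * c * x + E) + 32 * b * x * y) :=
    mul_nonneg (by linarith) (by positivity)
  linarith

/-- The secular cubic difference in `t_pp`: `charCubic(b) − charCubic(b′) = 16xy·(t(b′² − b²) + 2t_pd²(b′ − b))`. [folklore] -/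
theorem charCubic_sub_tpp (Δ a b b' c x y t : ℝ) :
    charCubic Δ a b c x y t - charCubic Δ a b' c x y t = 16 * x * y * (t * (b' ^ 2 - b ^ 2) + 2 * a ^ 2 * (b' - b)) := by
  unfold charCubic; ring

/-- **`ε_AB` is non-decreasing in `t_pp`** (`0 ≤ t_pp ≤ t_pp″`; `Δ, t_pp′, x, y ≥ 0`). [folklore] -/
theorem abBand_mono_tpp (hΔ : 0 ≤ Δ) (hc : 0 ≤ c) (hb : 0 ≤ b) (hx : 0 ≤ x) (hy : 0 ≤ y) (hbb : b ≤ b') :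
    abBand Δ a b c x y ≤ abBand Δ a b' c x y := by
  set E := abBand Δ a b c x y with hE
  have hE0 : 0 ≤ E := abBand_nonneg (tpd := a) hΔ hc hb hx hy
  apply le_abBand_of_charCubic_nonpos
  have hid := charCubic_sub_tpp Δ a b b' c x y E
  rw [charCubic_abBand] at hid
  have h1 : 0 ≤ b' ^ 2 - b ^ 2 := by nlinarith
  have : 0 ≤ 16 * x * y * (E * (b' ^ 2 - b ^ 2) + 2 * a ^ 2 * (b' - b)) := by
    apply mul_nonneg (by positivity)
    nlinarith [sq_nonneg a]
  linarith

/-- The rank-two identity in `t_pp′`: `charCubic(c + γ; t) = charCubic(c; t) + 4γx·minorX(c; y, t) + 4γy·minorY(c; x, t) + 16γ²xy·t`. [folklore] -/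
theorem charCubic_tppP_shift (Δ a b c x y t γ : ℝ) :
    charCubic Δ a b (c + γ) x y t =
      charCubic Δ a b c x y t + 4 * γ * x * minorX Δ a c y t + 4 * γ * y * minorY Δ a c x t + 16 * γ ^ 2 * x * y * t := by
  unfold charCubic minorX minorY; ring

/-- **`ε_AB` is non-increasing in `t_pp′`** (`γ ≥ 0`; `Δ > 0`, `t_pd ≠ 0`, `t_pp, t_pp′, x, y ≥ 0`). [folklore] -/
theorem abBand_anti_tppP {γ : ℝ} (hΔ : 0 < Δ) (ha : a ≠ 0) (hc : 0 ≤ c) (hb : 0 ≤ b) (hx : 0 ≤ x) (hy : 0 ≤ y) (hγ : 0 ≤ γ) :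
    abBand Δ a b (c + γ) x y ≤ abBand Δ a b c x y := by
  by_cases hxy : 0 < x + y
  · set E := abBand Δ a b c x y with hE
    have hEpos : 0 < E := abBand_pos_of_sum_pos hΔ ha hc hb hx hy hxy
    have hP := charCubic_abBand Δ a b c x y
    have hX := minorX_nonneg_of_contour hΔ.le hc hb hx hy hEpos hP
    have hY := minorY_nonneg_of_contour hΔ.le hc hb hx hy hEpos hP
    have hval : 0 ≤ charCubic Δ a b (c + γ) x y E := by
      rw [charCubic_tppP_shift, hP]
      have : 0 ≤ 4 * γ * x * minorX Δ a c y E := by positivity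
      have : 0 ≤ 4 * γ * y * minorY Δ a c x E := by positivity
      have : 0 ≤ 16 * γ ^ 2 * x * y * E := by positivity
      linarith
    by_contra hlt
    push Not at hlt
    have := charCubic_neg_of_pos_of_lt_abBand hΔ.le (by linarith) hb hx hy hEpos hlt
    linarith
  · have hx0 : x = 0 := by linarith
    have hy0 : y = 0 := by linarith
    rw [hx0, hy0, abBand_Gamma hΔ.le, abBand_Gamma hΔ.le]

end Band

/-! ## §2 Generic transfer: band domination ⇒ filling domination ⇒ Fermi-energy order -/

section Transfer

variable {Δ a b c Δ' a' b' c' : ℝ}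

/-- Pointwise band domination `ε_AB(θ) ≤ ε_AB(θ′)` ⇒ `abFilling θ′ ε ≤ abFilling θ ε`. [folklore] -/
theorem abFilling_le_of_abBand_le (h : ∀ x y : ℝ, 0 ≤ x → 0 ≤ y → abBand Δ a b c x y ≤ abBand Δ' a' b' c' x y) (ε : ℝ) :
    abFilling Δ' a' b' c' ε ≤ abFilling Δ a b c ε := by
  unfold abFilling
  refine div_le_div_of_nonneg_right ?_ (by positivity)
  refine ENNReal.toReal_mono (volume_abOccSet_ne_top _ _ _ _ _) (measure_mono ?_)
  intro k hk
  exact ⟨hk.1, le_trans (h _ _ (halfSq_nonneg _) (halfSq_nonneg _)) hk.2⟩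

/-- Filling domination ⇒ the row with the LARGER filling has the SMALLER Fermi energy (`0 < ν < 1` attained at both rows; the dominating
row has `Δ′, t_pp′, t_pp″ ≥ 0`). [folklore] -/
theorem fermiEnergyOf_le_of_abFilling_le (hΔ' : 0 ≤ Δ') (hc' : 0 ≤ c') (hb' : 0 ≤ b') (hΔ : 0 ≤ Δ) (hc : 0 ≤ c) (hb : 0 ≤ b)
    (h : ∀ ε : ℝ, abFilling Δ a b c ε ≤ abFilling Δ' a' b' c' ε) {ν : ℝ} (hν0 : 0 < ν) (hν1 : ν < 1)
    (hex : ∃ ε : ℝ, abFilling Δ a b c ε = ν) (hex' : ∃ ε : ℝ, abFilling Δ' a' b' c' ε = ν) :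
    fermiEnergyOf Δ' a' b' c' ν ≤ fermiEnergyOf Δ a b c ν := by
  have hf : abFilling Δ a b c (fermiEnergyOf Δ a b c ν) = ν := abFilling_fermiEnergyOf hΔ hc hb hν0 hν1 hex
  have hf' : abFilling Δ' a' b' c' (fermiEnergyOf Δ' a' b' c' ν) = ν := abFilling_fermiEnergyOf hΔ' hc' hb' hν0 hν1 hex'
  by_contra hlt
  push Not at hlt
  obtain ⟨k, hk, hkE⟩ := exists_gt_of_abFilling_lt_one (Δ := Δ') (a := a') (b := b') (c := c')
    (ε := fermiEnergyOf Δ' a' b' c' ν) (by rw [hf']; exact hν1)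
  have hstrict := abFilling_lt_abFilling (a := a') hΔ' hc' hb' (fermiEnergyOf_nonneg hΔ hc hb hν0 hν1 hex) hlt hk hkE.le
  have := h (fermiEnergyOf Δ a b c ν)
  linarith

end Transfer

/-! ## §3 The Fermi-energy levers -/

section FermiLevers

variable {Δ a a' b b' c ν : ℝ}

/-- **`ε_F(ν)` is non-decreasing in `t_pd²`.** [folklore] -/
theorem fermiEnergyOf_mono_tpdSq (hΔ : 0 ≤ Δ) (hc : 0 ≤ c) (hb : 0 ≤ b) (haa : a ^ 2 ≤ a' ^ 2) (hν0 : 0 < ν) (hν1 : ν < 1)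
    (hex : ∃ ε : ℝ, abFilling Δ a b c ε = ν) (hex' : ∃ ε : ℝ, abFilling Δ a' b c ε = ν) :
    fermiEnergyOf Δ a b c ν ≤ fermiEnergyOf Δ a' b c ν :=
  fermiEnergyOf_le_of_abFilling_le hΔ hc hb hΔ hc hb
    (fun ε => abFilling_le_of_abBand_le (fun _ _ hx hy => abBand_mono_tpdSq hΔ hc hb hx hy haa) ε) hν0 hν1 hex' hex

/-- **`ε_F(ν)` is non-decreasing in `t_pp`.** [folklore] -/
theorem fermiEnergyOf_mono_tpp (hΔ : 0 ≤ Δ) (hc : 0 ≤ c) (hb : 0 ≤ b) (hbb : b ≤ b') (hν0 : 0 < ν) (hν1 : ν < 1)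
    (hex : ∃ ε : ℝ, abFilling Δ a b c ε = ν) (hex' : ∃ ε : ℝ, abFilling Δ a b' c ε = ν) :
    fermiEnergyOf Δ a b c ν ≤ fermiEnergyOf Δ a b' c ν :=
  fermiEnergyOf_le_of_abFilling_le hΔ hc hb hΔ hc (hb.trans hbb)
    (fun ε => abFilling_le_of_abBand_le (fun _ _ hx hy => abBand_mono_tpp hΔ hc hb hx hy hbb) ε) hν0 hν1 hex' hex

/-- **`ε_F(ν)` is non-increasing in `t_pp′`** (`Δ > 0`, `t_pd ≠ 0`). [folklore] -/
theorem fermiEnergyOf_anti_tppP {γ : ℝ} (hΔ : 0 < Δ) (ha : a ≠ 0) (hc : 0 ≤ c) (hb : 0 ≤ b) (hγ : 0 ≤ γ) (hν0 : 0 < ν) (hν1 : ν < 1)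
    (hex : ∃ ε : ℝ, abFilling Δ a b c ε = ν) (hex' : ∃ ε : ℝ, abFilling Δ a b (c + γ) ε = ν) :
    fermiEnergyOf Δ a b (c + γ) ν ≤ fermiEnergyOf Δ a b c ν :=
  fermiEnergyOf_le_of_abFilling_le hΔ.le (by linarith) hb hΔ.le hc hb
    (fun ε => abFilling_le_of_abBand_le (fun _ _ hx hy => abBand_anti_tppP hΔ ha hc hb hx hy hγ) ε) hν0 hν1 hex hex'

end FermiLevers

end Summit.Ventures.CertifiedManyBodySolver.Downfold.Emery
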